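import Summits.BirchSwinnertonDyer.BirchSwinnertonDyer.Theorems.EisensteinPrimesMazurMCOnX1RankZeroInterludeResidualGL1Tame
import Literature.NumberTheory.EllipticCurves.H1CorestrictionIndexTwo
import Literature.NumberTheory.EllipticCurves.GreenbergVatsal2000.UnramifiedOutsideFinite
import Literature.NumberTheory.EllipticCurves.CyclotomicZpExtension
import Literature.NumberTheory.EllipticCurves.ZpExtensionProofs
import Literature.NumberTheory.EllipticCurves.HeegnerPointsImaginaryQuadraticProofs
import Literature.NumberTheory.GaloisRepresentations.AbsIntegersEquiv
import Literature.NumberTheory.GaloisRepresentations.InducedGaloisRep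
import Literature.NumberTheory.GaloisRepresentations.ArtinFormalismInductionProofs
import HarnessLib

/-!
# Crux `MazurMCOnX1RankZero` (stmt-BirchSwinnertonDyer-19035), line `interlude_with_torsion` (v10), road B (B3):
# the input [Even] (`stub_greenbergEvenInput`) FROM Greenberg's Lemma 5.9 over `ℚ_∞` — the index-`2` transport
# `H¹(ℚ_∞, M) ⟶ H¹(K_∞, M)` (res / cor for `res(ker κ_K) ⊲ ker κ_ℚ`, index `2`) and the quadratic twist `M ⊗ ε_K`
# (ideator `bsd-idea-11`, lens nearmiss, g17, object #2; publish-only crux workfile, W-71 / W-79 honoured)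

WHAT THIS FILE DOES (numbers, not adjectives).  The skeleton `interlude_with_torsion` v10 of crux 5 splits (B3)
`InterludeWithTorsion.ResidualGL1FinitenessOdd` into [Unr] (`stub_gl1InputUnramified`; discharged modulo Ferrero–Washington in
the companion workfile `Lines/interlude_roadB_UnrTransport_idea11g17.lean`) and **[Even]** = `stub_greenbergEvenInput`, whose type
is W2's `hEven` of `InterludeWithTorsion.residualGL1FinitenessOdd_of_unr_even'`: for `K` imaginary quadratic, `p ≠ 2`, `κ` the
cyclotomic `ℤ_p`-extension of `K`, `M` a `Γ_ℚ`-module of order `p` restricted to `Γ_K`, SOME `τ ∉ res(Γ_K)` has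
`(1 + T_τ) · U_K` or `(1 - T_τ) · U_K` finite, where `U_K = unramifiedOutside (ker κ) M p ∅ ⊆ H¹(K_∞, M)` are the classes
unramified away from `p` and `T_τ = cycSwapH1 κ hκ M hM τ` is the outer action of `τ`.  This file proves

* **`greenbergEvenInput_of_lemma59 : GreenbergLemma59 → [Even]`** with `[Even]` token-for-token that type, and
* **`residualGL1FinitenessOdd_of_unr_lemma59 : [Unr] → GreenbergLemma59 → InterludeWithTorsion.ResidualGL1FinitenessOdd`**
  (by `residualGL1FinitenessOdd_of_unr_even'`, tree),

where **`GreenbergLemma59 : Prop`** (§9) is the DISPLAY FORM over `ℚ_∞` of R. Greenberg, LNM 1716 (1999), Lemma 5.9, even case,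
`p` odd: *for a `Gal(ℚ_Σ/ℚ)`-module `Θ` cyclic of order `p`, `Θ` even, `H¹(ℚ_Σ/ℚ_∞, Θ)` is finite* — typed in the tree's
place-by-place formalism as finiteness of `unramifiedOutside (ker κ_ℚ) Θ p ∅ ⊆ H¹(ℚ_∞, Θ)` for a discrete continuous `Γ_ℚ`-module
`Θ` with `#Θ = p` on which every complex conjugation acts trivially (`Σ ⊇ {p, ∞} ∪ Ram(Θ)`; our set is the subgroup of
`H¹(ℚ_Σ/ℚ_∞, Θ)` of classes unramified at every `v ≠ p`).  It is a PUBLISHED THEOREM displayed as a hypothesis (to be typed as a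
named fact of `Literature/NumberTheory/IwasawaTheory` by a typer / W seat; Greenberg's proof: `C = (ℚ_p/ℤ_p)(θ)`,
`S'_C(ℚ_∞) ≅ Hom(Y^θ, C)` with `Y = Gal(M_∞/F_∞)`, Iwasawa's rank theorem and Ferrero–Washington `μ = 0`, pp. 142–144).
No summit statement, no instance of BSD and no Mazur main conjecture is proved here; crux 5 thereby rests BY NAME on
PUB ∪ {Ferrero–Washington, `classicalMuVanishes_finite_unramifiedClasses`, Lemma 5.9} ∧ crux 2 ∧ XI″.

THE MECHANISM (Greenberg, proof of Lemma 5.9: «the restriction map `H¹(ℚ_Σ/ℚ_∞, C) → H¹(ℚ_Σ/F_∞, C)^Δ` is an isomorphism»,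
run for the quadratic field `K` and made sign-sensitive).
* §1–§2 `IndexTwo`.  `Γ := ker κ_ℚ ≤ Γ_ℚ` (closed, compact), `N := res⁻¹`-saturated image `resRangeIn κ_ℚ = Γ ∩ res(Γ_K)` is OPEN and
  NORMAL of index `2` in `Γ` with `Γ = N ⊔ c₀N` for any `c₀ ∈ Γ_ℚ ∖ res(Γ_K)` with `c₀² = 1` (`xor_resRangeIn`; `c₀ ∈ ker κ_ℚ`
  automatically, `mem_kerSubgroup_of_mul_self_eq_one`, `p` odd); `res : ker κ_K ≃ₜ* N` (`resKer`, `resKerHomeo`: bijective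
  continuous from compact to Hausdorff), giving the transports `Φ = toN : H¹(ker κ_K, M) → H¹(N, M)` and `Ψ = ofN` with
  `Ψ Φ = 1` (`ofN_toN`) and `Ψ ∘ conj_{c₀} = T_{c₀} ∘ Ψ` (`ofN_conjH1`; `T = cycSwapH1` is W2's outer action).
* §3 `Generic`.  For `J ≤ Γ`, `[Γ : N] = 2`, `M` of odd prime order: a class of `H¹(J, M)` vanishing on `J ∩ N` vanishes
  (`2 · η = 0` from `res ∘ cor`, `p · η = 0`, `p` odd) — `resSubgroupH1_eq_zero_of_res_subgroupOf_eq_zero`.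
* §4 `Places`.  Prime bookkeeping along `ℤ̄_ℚ = ℤ̄_K` (`AbsIntegersEquiv`): every prime `𝔓` of `ℤ̄` over `v ∤ p` of `ℚ` lies over
  a place `w ∤ p` of `K` (`exists_place_primeOver`), inertia groups match (`mem_inertia_primeOver_iff`), and the converse
  Greenberg–Vatsal criterion `conjH1_mem_unramifiedKer_of_forall_resOfLe`.
* §5 `Core`.  For `x ∈ U_K`: `cor(Φ x) ∈ H¹(Γ, M)` is unramified at every `v ∤ p` (`cor_toN_mem_unramifiedOutside`: on
  `I_𝔓 ∩ N` the corestricted cocycle is the coboundary of `a₁ + c₀ • a₂` read off the two `K`-places under `𝔓` and `c₀⁻¹ 𝔓`,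
  then §3), and `x + T_{c₀} x = Ψ (res_N (cor (Φ x)))` (`add_cycSwapH1_eq`, from `res ∘ cor = 1 + conj_{c₀}` of the tool
  `H1CorestrictionIndexTwo`).  Hence **`finite_image_add_cycSwapH1`**: `U_ℚ := unramifiedOutside (ker κ_ℚ) M p ∅` finite ⟹
  `(1 + T_{c₀}) · U_K ⊆ Ψ res_N (U_ℚ)` finite.
* §6 `PrimeOrder`.  On a module of prime order every group element acts by an integer scalar; an involution acts by `±1`
  (`smul_eq_self_or_eq_neg`); conjugate elements act alike (`smul_eq_smul_of_isConj`) — so ALL complex conjugations act by the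
  sign of one of them (`IsComplexConjugation.isConj`).
* §7 `Upgrade`.  `Γ_K`-continuity ⟹ `Γ_ℚ`-continuity along the open embedding `res` (`continuous_smul_of_continuous_restrict`).
* §8 `Twist`.  The type synonym `Twist K M = M ⊗ ε_K`: same `Γ_K`-module, `Γ_ℚ` acting by `g • x` on `res(Γ_K)` and `-(g • x)` off
  it (a `DistribMulAction`, `[K:ℚ] = 2`); `hM` survives (`Twist.compat`); an element acting by `-1` on `M` off `res(Γ_K)` acts
  trivially on the twist; `H¹(H, Twist K M) = H¹(H, M)` for `H ≤ Γ_K` (typed identities `h1Cast`, `h1CastInv`, `cocycleCast`).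
* §9 `Assembly`.  **`cycSwapH1_twist`**: `T_{c₀}` of the twist is `-T_{c₀}` of `M` (cocycle values `c₀ • z(θ x)` change sign).
  **`greenbergEvenInput_of_lemma59`**: `τ := c₀` a complex conjugation (`∉ res(Γ_K)` as `K` is totally complex); if `ker κ_K`
  does not act continuously then `H¹(K_∞, M) = 0` (W2, `discreteH1_eq_zero_of_not_continuous`), else the actions are continuous
  (`continuous_smul_of_continuous_smul_kerSubgroup`, §7); if `c₀ = +1` on `M`, `M` is even and Lemma 5.9 + §5 give the `+`
  disjunct; if `c₀ = -1`, `M ⊗ ε_K` is even, Lemma 5.9 + §5 for the twist and `cycSwapH1_twist` give the `-` disjunct.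

LEDGER: farm `lean check` rc 0 · errors 0 · warnings 0 · sorries 0; conditional input = exactly `GreenbergLemma59` (displayed,
cited); no axioms beyond the standard three; imports only landed `Theorems/` and `Literature/` modules.  For the LEAD
(`cruxlead-19035`): v11 recipe — `stub_publishedAll` gains `GreenbergLemma59` (or its Literature name once typed) and
`theorem stub_greenbergEvenInput := EvenTransport.greenbergEvenInput_of_lemma59 hPub.lemma59`.

References: R. Greenberg, *Iwasawa theory for elliptic curves*, LNM 1716 (1999), Lemma 5.9 and its proof, pp. 142–144 of the held
copy `book:coates1999-arithmetic-theory-elliptic-curves` [Greenberg1999LNM]; B. Ferrero, L. Washington, Ann. of Math. 109 (1979)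
[FerreroWashington1979]; J.-P. Serre, *Galois Cohomology*, I §2.4–2.6 (res, cor, `cor ∘ res`), I §5.3 (twisting)
[SerreGaloisCohomology1997]; R. Greenberg, V. Vatsal, Invent. Math. 142 (2000), §2 (place-by-place Selmer conditions)
[GreenbergVatsal2000]; J. Neukirch, *Algebraic Number Theory*, Ch. I §9, Ch. IV §1 [NeukirchANT1999].
-/

noncomputable section

set_option linter.dupNamespace false
set_option autoImplicit false

open scoped NumberField Pointwise
open Field IsDedekindDomain
open Literature.NumberTheory.GaloisRepresentations
open Literature.NumberTheory.EllipticCurves Literature.NumberTheory.EllipticCurves.GreenbergSelmer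
open Literature.NumberTheory.EllipticCurves.GreenbergVatsal2000

namespace Summit.BirchSwinnertonDyer.BirchSwinnertonDyer.Theorems.InterludeWithTorsion.EvenTransport

/-! ## §1 Kernels of cyclotomic `ℤ_p`-extensions under restriction `Γ_K → Γ_ℚ` -/

section Kernels

variable {K : Type} [Field K] [NumberField K] {p : ℕ} [Fact p.Prime]
variable (κ : ZpExtension K p) (hκ : κ.IsCyclotomic) (κQ : ZpExtension ℚ p) (hκQ : κQ.IsCyclotomic)

include hκ hκQ in
/-- **`res σ ∈ ker κ_ℚ^{cyc} ↔ σ ∈ ker κ_K^{cyc}`**: both kernels are `χ_p⁻¹(μ(ℤ_p))` (`ZpExtension.IsCyclotomic`) and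
`χ_{p,ℚ} ∘ res = χ_{p,K}` (`cyclotomicCharacter_absGaloisRestrict`). [cite: Washington1997, §13.1] -/
theorem absGaloisRestrict_mem_kerSubgroup_iff (σ : absoluteGaloisGroup K) :
    absGaloisRestrict ℚ K σ ∈ κQ.kerSubgroup ↔ σ ∈ κ.kerSubgroup := by
  haveI : NeZero (p : ℚ) := ⟨Nat.cast_ne_zero.mpr (Fact.out : p.Prime).ne_zero⟩
  have h1 : κ.kerSubgroup = (CommGroup.torsion ℤ_[p]ˣ).comap (GaloisRep.cyclotomicCharacter K p).toMonoidHom := hκ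
  have h2 : κQ.kerSubgroup = (CommGroup.torsion ℤ_[p]ˣ).comap (GaloisRep.cyclotomicCharacter ℚ p).toMonoidHom := hκQ
  rw [h1, h2, Subgroup.mem_comap, Subgroup.mem_comap]
  change GaloisRep.cyclotomicCharacter ℚ p (absGaloisRestrict ℚ K σ) ∈ CommGroup.torsion ℤ_[p]ˣ ↔
    GaloisRep.cyclotomicCharacter K p σ ∈ CommGroup.torsion ℤ_[p]ˣ
  rw [cyclotomicCharacter_absGaloisRestrict ℚ K p]

include hκQ in
/-- An involution of `Γ_ℚ` lies in `ker κ_ℚ^{cyc}` (its cyclotomic character is `±1`, a torsion unit). [folklore] -/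
theorem mem_kerSubgroup_of_mul_self_eq_one {c₀ : absoluteGaloisGroup ℚ} (hc₀ : c₀ * c₀ = 1) : c₀ ∈ κQ.kerSubgroup := by
  haveI : NeZero (p : ℚ) := ⟨Nat.cast_ne_zero.mpr (Fact.out : p.Prime).ne_zero⟩
  have h2 : κQ.kerSubgroup = (CommGroup.torsion ℤ_[p]ˣ).comap (GaloisRep.cyclotomicCharacter ℚ p).toMonoidHom := hκQ
  rw [h2, Subgroup.mem_comap]
  change GaloisRep.cyclotomicCharacter ℚ p c₀ ∈ CommGroup.torsion ℤ_[p]ˣ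
  rw [CommGroup.mem_torsion, isOfFinOrder_iff_pow_eq_one]
  exact ⟨2, two_pos, by rw [pow_two, ← map_mul, hc₀, map_one]⟩

omit [NumberField K] in
omit [NumberField K] in
/-- `ker κ` is compact. [folklore] -/
instance compactSpace_kerSubgroup : CompactSpace κ.kerSubgroup :=
  isCompact_iff_compactSpace.mp (ZpExtension.isClosed_kerSubgroup κ).isCompact

end Kernels

/-! ## §2 The index-`2` pair `res(ker κ_K) ⊲ ker κ_ℚ` inside `Γ_ℚ` and the transport of `H¹` along `res` -/

section IndexTwo

variable {K : Type} [Field K] [NumberField K] {p : ℕ} [Fact p.Prime]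
variable (κ : ZpExtension K p) (hκ : κ.IsCyclotomic) (κQ : ZpExtension ℚ p) (hκQ : κQ.IsCyclotomic)

/-- `N = ker κ_ℚ ∩ res(Γ_K)` as a subgroup of `Γ := ker κ_ℚ` (for cyclotomic `κ, κ_ℚ` this is `res(ker κ_K)`,
`absGaloisRestrict_mem_kerSubgroup_iff`). [folklore] -/
def resRangeIn : Subgroup κQ.kerSubgroup := (absGaloisRestrict ℚ K).range.comap κQ.kerSubgroup.subtype

/-- Membership in `resRangeIn`. [folklore] -/
theorem mem_resRangeIn_iff (g : κQ.kerSubgroup) :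
    g ∈ resRangeIn (K := K) κQ ↔ (g : absoluteGaloisGroup ℚ) ∈ (absGaloisRestrict ℚ K).range := Iff.rfl

/-- `N` is open in `Γ` (`res` is an open embedding for the finite extension `K/ℚ`). [folklore] -/
theorem isOpen_resRangeIn : IsOpen (resRangeIn (K := K) κQ : Set κQ.kerSubgroup) :=
  (isOpenEmbedding_absGaloisRestrict ℚ K).isOpen_range.preimage continuous_subtype_val

/-- For `[K : ℚ] = 2` (Galois), `res(Γ_K)` has index `2` in `Γ_ℚ`, hence is normal; so is `N` in `Γ`. [folklore] -/
theorem normal_resRangeIn [IsGalois ℚ K] (h2 : Module.finrank ℚ K = 2) : (resRangeIn (K := K) κQ).Normal := by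
  haveI : FiniteDimensional ℚ K := Module.finite_of_finrank_eq_succ h2
  haveI : (absGaloisRestrict ℚ K).range.Normal :=
    Subgroup.normal_of_index_eq_two (by rw [index_range_absGaloisRestrict_eq_finrank ℚ K, h2])
  exact Subgroup.Normal.comap inferInstance _

variable {κQ} in
include hκQ in
/-- The involution `c₀` as an element of `Γ = ker κ_ℚ`. [folklore] -/
def invol {c₀ : absoluteGaloisGroup ℚ} (hc₀ : c₀ * c₀ = 1) : κQ.kerSubgroup :=
  ⟨c₀, mem_kerSubgroup_of_mul_self_eq_one κQ hκQ hc₀⟩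

variable {κQ} in
/-- Coercion of `invol`. [folklore] -/
@[simp] theorem coe_invol {c₀ : absoluteGaloisGroup ℚ} (hc₀ : c₀ * c₀ = 1) :
    ((invol hκQ hc₀ : κQ.kerSubgroup) : absoluteGaloisGroup ℚ) = c₀ := rfl

/-- `res(Γ_K)` is closed under inverses (as a set). [folklore] -/
theorem inv_not_mem_range {g : absoluteGaloisGroup ℚ} (hg : g ∉ Set.range (absGaloisRestrict ℚ K)) :
    g⁻¹ ∉ Set.range (absGaloisRestrict ℚ K) := by
  intro h
  apply hg
  have h' : g⁻¹ ∈ (absGaloisRestrict ℚ K).range := h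
  have := (absGaloisRestrict ℚ K).range.inv_mem h'
  rw [inv_inv] at this
  exact this

/-- **`Γ = N ⊔ N c₀`** for an involution `c₀ ∉ res(Γ_K)` and `[K : ℚ] = 2`: the `Xor` form used by the corestriction
tool `H1CorestrictionIndexTwo`. [folklore] -/
theorem xor_resRangeIn (h2 : Module.finrank ℚ K = 2) {c₀ : absoluteGaloisGroup ℚ} (hc₀ : c₀ * c₀ = 1)
    (hc₀K : c₀ ∉ Set.range (absGaloisRestrict ℚ K)) (b : κQ.kerSubgroup) :
    Xor (b * (invol hκQ hc₀)⁻¹ ∈ resRangeIn (K := K) κQ) (b ∈ resRangeIn (K := K) κQ) := by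
  by_cases hb : (b : absoluteGaloisGroup ℚ) ∈ (absGaloisRestrict ℚ K).range
  · refine Or.inr ⟨hb, fun h ↦ hc₀K ?_⟩
    rw [mem_resRangeIn_iff] at h
    have h' : (b : absoluteGaloisGroup ℚ)⁻¹ * ((b : absoluteGaloisGroup ℚ) * c₀⁻¹) ∈ (absGaloisRestrict ℚ K).range :=
      (absGaloisRestrict ℚ K).range.mul_mem ((absGaloisRestrict ℚ K).range.inv_mem hb) h
    rw [inv_mul_cancel_left] at h'
    have := (absGaloisRestrict ℚ K).range.inv_mem h'
    rwa [inv_inv] at this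
  · refine Or.inl ⟨?_, hb⟩
    rw [mem_resRangeIn_iff]
    have hb' : (b : absoluteGaloisGroup ℚ)⁻¹ ∉ Set.range (absGaloisRestrict ℚ K) := inv_not_mem_range hb
    have hc' : c₀⁻¹ ∉ Set.range (absGaloisRestrict ℚ K) := inv_not_mem_range hc₀K
    have key := inv_mul_mem_range_absGaloisRestrict h2 hb' hc'
    rw [inv_inv] at key
    exact key

/-- `res : ker κ_K → N`, `σ ↦ res σ` (well defined for cyclotomic `κ, κ_ℚ`). [folklore] -/
def resKer : κ.kerSubgroup →ₜ* resRangeIn (K := K) κQ where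
  toFun σ := ⟨⟨absGaloisRestrict ℚ K σ, (absGaloisRestrict_mem_kerSubgroup_iff κ hκ κQ hκQ σ).mpr σ.2⟩, ⟨σ, rfl⟩⟩
  map_one' := Subtype.ext (Subtype.ext (by simp))
  map_mul' x y := Subtype.ext (Subtype.ext (by simp))
  continuous_toFun :=
    (((absGaloisRestrict ℚ K).continuous.comp continuous_subtype_val).subtype_mk _).subtype_mk _

/-- Unfolding `resKer`. [folklore] -/
@[simp] theorem resKer_coe_coe (σ : κ.kerSubgroup) :
    (((resKer κ hκ κQ hκQ σ : resRangeIn (K := K) κQ) : κQ.kerSubgroup) : absoluteGaloisGroup ℚ) =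
      absGaloisRestrict ℚ K σ := rfl

/-- `res : ker κ_K → N` is bijective. [folklore] -/
theorem resKer_bijective : Function.Bijective (resKer κ hκ κQ hκQ) := by
  constructor
  · intro x y h
    have h' := congrArg (fun n : resRangeIn (K := K) κQ ↦ ((n : κQ.kerSubgroup) : absoluteGaloisGroup ℚ)) h
    simp only [resKer_coe_coe] at h'
    exact Subtype.ext (absGaloisRestrict_injective ℚ K h')
  · intro n
    obtain ⟨σ, hσ⟩ := (mem_resRangeIn_iff κQ _).mp n.2
    have hσ' : absGaloisRestrict ℚ K σ = ((n : κQ.kerSubgroup) : absoluteGaloisGroup ℚ) := hσ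
    have hσker : σ ∈ κ.kerSubgroup := by
      rw [← absGaloisRestrict_mem_kerSubgroup_iff κ hκ κQ hκQ σ, hσ']
      exact (n : κQ.kerSubgroup).2
    exact ⟨⟨σ, hσker⟩, Subtype.ext (Subtype.ext hσ')⟩

/-- `res : ker κ_K ≃ₜ N` (a continuous bijection from a compact space to a Hausdorff space). [folklore] -/
def resKerHomeo : κ.kerSubgroup ≃ₜ resRangeIn (K := K) κQ :=
  Continuous.homeoOfEquivCompactToT2 (f := Equiv.ofBijective _ (resKer_bijective κ hκ κQ hκQ))
    (resKer κ hκ κQ hκQ).continuous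

/-- `resKerHomeo` is `resKer` as a function. [folklore] -/
@[simp] theorem resKerHomeo_apply (σ : κ.kerSubgroup) : resKerHomeo κ hκ κQ hκQ σ = resKer κ hκ κQ hκQ σ := rfl

/-- The inverse `res⁻¹ : N → ker κ_K` as a continuous homomorphism. [folklore] -/
def resKerInv : resRangeIn (K := K) κQ →ₜ* κ.kerSubgroup where
  toFun := (resKerHomeo κ hκ κQ hκQ).symm
  map_one' := (resKerHomeo κ hκ κQ hκQ).injective (by
    rw [Homeomorph.apply_symm_apply, resKerHomeo_apply, map_one])
  map_mul' x y := (resKerHomeo κ hκ κQ hκQ).injective (by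
    rw [Homeomorph.apply_symm_apply, resKerHomeo_apply, map_mul, ← resKerHomeo_apply, ← resKerHomeo_apply,
      Homeomorph.apply_symm_apply, Homeomorph.apply_symm_apply])
  continuous_toFun := (resKerHomeo κ hκ κQ hκQ).symm.continuous

/-- `res (res⁻¹ n) = n`. [folklore] -/
@[simp] theorem resKer_resKerInv (n : resRangeIn (K := K) κQ) : resKer κ hκ κQ hκQ (resKerInv κ hκ κQ hκQ n) = n := by
  change resKerHomeo κ hκ κQ hκQ ((resKerHomeo κ hκ κQ hκQ).symm n) = n
  exact Homeomorph.apply_symm_apply _ n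

/-- `res⁻¹ (res σ) = σ`. [folklore] -/
@[simp] theorem resKerInv_resKer (σ : κ.kerSubgroup) : resKerInv κ hκ κQ hκQ (resKer κ hκ κQ hκQ σ) = σ := by
  change (resKerHomeo κ hκ κQ hκQ).symm (resKerHomeo κ hκ κQ hκQ σ) = σ
  exact Homeomorph.symm_apply_apply _ σ

/-- `res ((res⁻¹ n : ker κ_K) : Γ_K) = n` in `Γ_ℚ`. [folklore] -/
theorem absGaloisRestrict_resKerInv (n : resRangeIn (K := K) κQ) :
    absGaloisRestrict ℚ K (resKerInv κ hκ κQ hκQ n : κ.kerSubgroup) = ((n : κQ.kerSubgroup) : absoluteGaloisGroup ℚ) := by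
  rw [← resKer_coe_coe κ hκ κQ hκQ, resKer_resKerInv]

variable (M : Type) [AddCommGroup M] [DistribMulAction (absoluteGaloisGroup ℚ) M]
  [DistribMulAction (absoluteGaloisGroup K) M] [TopologicalSpace M] [DiscreteTopology M]
  (hM : ∀ (σ : absoluteGaloisGroup K) (m : M), σ • m = absGaloisRestrict ℚ K σ • m)

omit [TopologicalSpace M] [DiscreteTopology M] in
include hM in
/-- Compatibility of `(res⁻¹, id_M)`. [folklore] -/
theorem resKerInv_compat (n : resRangeIn (K := K) κQ) (m : M) :
    AddMonoidHom.id M (resKerInv κ hκ κQ hκQ n • m) = n • m := by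
  rw [AddMonoidHom.id_apply, Subgroup.smul_def, hM, absGaloisRestrict_resKerInv, Subgroup.smul_def, Subgroup.smul_def]

omit [TopologicalSpace M] [DiscreteTopology M] in
include hM in
/-- Compatibility of `(res, id_M)`. [folklore] -/
theorem resKer_compat (σ : κ.kerSubgroup) (m : M) :
    AddMonoidHom.id M (resKer κ hκ κQ hκQ σ • m) = σ • m := by
  rw [AddMonoidHom.id_apply, Subgroup.smul_def, Subgroup.smul_def, resKer_coe_coe, Subgroup.smul_def, hM]

/-- **Transport `Φ : H¹(ker κ_K, M) → H¹(N, M)`** along `res⁻¹ : N ≃ ker κ_K`. [cite: SerreGaloisCohomology1997, I §2.4] -/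
def toN : subgroupH1 κ.kerSubgroup M →+ subgroupH1 (resRangeIn (K := K) κQ) M :=
  resH1Hom (resKerInv κ hκ κQ hκQ) (AddMonoidHom.id M) (resKerInv_compat κ hκ κQ hκQ M hM)

/-- **Transport `Ψ : H¹(N, M) → H¹(ker κ_K, M)`** along `res : ker κ_K ≃ N`. [cite: SerreGaloisCohomology1997, I §2.4] -/
def ofN : subgroupH1 (resRangeIn (K := K) κQ) M →+ subgroupH1 κ.kerSubgroup M :=
  resH1Hom (resKer κ hκ κQ hκQ) (AddMonoidHom.id M) (resKer_compat κ hκ κQ hκQ M hM)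

/-- `Φ` on an explicit class. [folklore] -/
theorem toN_oneCocycleClass (z : contOneCocycles (discreteTopRep κ.kerSubgroup M)) :
    toN κ hκ κQ hκQ M hM (oneCocycleClass _ z) =
      oneCocycleClass _ (contOneCocycles.pullback (resKerInv κ hκ κQ hκQ)
        (resHomOfEquivariant _ _ (resKerInv_compat κ hκ κQ hκQ M hM)) z) :=
  resH1Hom_oneCocycleClass _ _ _ z

/-- `Ψ` on an explicit class. [folklore] -/
theorem ofN_oneCocycleClass (f : contOneCocycles (discreteTopRep (resRangeIn (K := K) κQ) M)) :
    ofN κ hκ κQ hκQ M hM (oneCocycleClass _ f) =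
      oneCocycleClass _ (contOneCocycles.pullback (resKer κ hκ κQ hκQ)
        (resHomOfEquivariant _ _ (resKer_compat κ hκ κQ hκQ M hM)) f) :=
  resH1Hom_oneCocycleClass _ _ _ f

/-- **`Ψ ∘ Φ = id`**. [folklore] -/
theorem ofN_toN (x : subgroupH1 κ.kerSubgroup M) : ofN κ hκ κQ hκQ M hM (toN κ hκ κQ hκQ M hM x) = x := by
  obtain ⟨z, rfl⟩ := oneCocycleClass_surjective _ x
  rw [toN_oneCocycleClass, ofN_oneCocycleClass]
  congr 1
  apply Subtype.ext
  ext σ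
  rw [pullback_resHomOfEquivariant_apply, pullback_resHomOfEquivariant_apply, AddMonoidHom.id_apply,
    AddMonoidHom.id_apply, resKerInv_resKer]

/-- **`Ψ` intertwines the conjugation `c_*` on `H¹(N, M)` with the swap `T_{c₀}` on `H¹(ker κ_K, M)`**: both are
`[f] ↦ [x ↦ c₀ • f(c₀⁻¹ x c₀)]` read through `res`. [cite: SerreGaloisCohomology1997, I §2.5] -/
theorem ofN_conjH1 [IsGalois ℚ K] [(resRangeIn (K := K) κQ).Normal] {c₀ : absoluteGaloisGroup ℚ} (hc₀ : c₀ * c₀ = 1)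
    (ξ : subgroupH1 (resRangeIn (K := K) κQ) M) :
    ofN κ hκ κQ hκQ M hM (conjH1 (resRangeIn (K := K) κQ) M (invol hκQ hc₀) ξ) =
      cycSwapH1 κ hκ M hM c₀ (ofN κ hκ κQ hκQ M hM ξ) := by
  obtain ⟨f, rfl⟩ := oneCocycleClass_surjective _ ξ
  rw [conjH1_oneCocycleClass, ofN_oneCocycleClass, ofN_oneCocycleClass, cycSwapH1_eq, outerConjH1_oneCocycleClass]
  congr 1
  apply Subtype.ext
  ext σ
  rw [pullback_resHomOfEquivariant_apply, AddMonoidHom.id_apply, conjCocycle_apply,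
    outerConj_pullback_apply κ.kerSubgroup _ M hM, pullback_resHomOfEquivariant_apply, AddMonoidHom.id_apply]
  have e : subgroupConj (resRangeIn (K := K) κQ) (invol hκQ hc₀) (resKer κ hκ κQ hκQ σ) =
      resKer κ hκ κQ hκQ (outerConjSubgroup κ.kerSubgroup (absGaloisOuterConj_mem_kerSubgroup κ hκ) c₀ σ) := by
    apply Subtype.ext
    apply Subtype.ext
    rw [resKer_coe_coe, outerConjSubgroup_apply_coe, absGaloisRestrict_absGaloisOuterConj, inv_inv]
    rfl
  rw [e]
  rfl

end IndexTwo

end Summit.BirchSwinnertonDyer.BirchSwinnertonDyer.Theorems.InterludeWithTorsion.EvenTransport
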